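import Summits.QuantumFields.YangMills.Theorems.UV3BranchExpansionMuteCancellationDead
import Summits.QuantumFields.YangMills.Theorems.UV3BranchExpansionMuteDichotomy
import Summits.QuantumFields.YangMills.Theorems.UV3BranchExpansionGuardedTower
import HarnessLib

/-!
# R3 (cell `ym3-torus`, YM₃ on T³ — a ladder RUNG, NOT d = 4, NOT infinite volume, NOT a mass gap, NOT the Clay problem) —
# **(F-JOIN) `hM` OF THE SOCKET FOR EVERY NON-DISCOVERABLE HISTORY: the (M)∕(M′) join — a history that is NOT discoverable has a MUTE site (w5's dichotomy
# over w2's (M′)), and at a mute site the two branch measures coincide (px8's (M)) — in the model's letters, with the slices of the history**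

Width seat `ym3-torus-px8` g13 on crux `stmt-QuantumFields-19936` `UnitScaleTilt.HistoryTailL` (`--supports`, helper; THEOREMS ONLY, 0 `def`, 0 `sorry`,
default heartbeats).  JOIN of LEAD ★w1-19936 g12's note `Cruxes/HistoryTailL/HTopBranchExpansion.md` §4 (M) and §5 (M′): w5 g19's ABSTRACT dichotomy
✓`UV3BranchExpansionMuteDichotomy.exists_mute_of_not_discoverable` ∕ `exists_exit_chain_rel` (letters `β R line Dist X N` of w2 g17's (C′)∕(M′)) instantiated at the T³ tower
`β i := PBond P (j+i)` and pushed through the MODEL DICTIONARY into px8's ✓`UV3BranchExpansionMuteCancellation.socket_hM_of_mute` (exit ending) ∕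
✓`UV3BranchExpansionMuteCancellationDead.socket_hM_of_deadTower` (dead ending).  RECORD CURRENCY: record-independent kinematics; read by no row of the χ record
`AlphaInputsT3ACv4RecChi`; nothing of hTop, of the record, of `HistoryTailL` or of rung R3 is proved here.

THE MODEL DICTIONARY (hypothesis-specified, as in w5's ✓`UV3BranchExpansionCountingT3`): `lineF i g` = the segment of `g` (`hlineF : b ∈ lineF i g ↔ ∃ t < L, b = line g t`),
`Rd i c ⊇` the loop-word bonds of the (0.4) guard of `c` (`hRd′`, the REVERSE half of w5's `hRd` — unreadness is what (M) consumes), `Dist X N` = (F-TOP)'s ONE recursion (w2's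
`hDistS hXm hXS` + `hRline`, passed through untouched), histories `s` = finsets of `Σ i : Fin n, PBond P (j+i+1)` with slices `p i := univ.filter (⟨i, ·⟩ ∈ s)`, `V s` the hybrid
trajectory (`hV0 hVs` VERBATIM as in LEAD's socket ✓`UV3BranchExpansionGuardedTower.map_iterFrom_le_smul_of_branchExpansion`).

CONTENTS.  `forall_lt_of_mem_lineF` (dictionary), ★★★ `map_iterFrom_le_smul_of_discoverable` (THE SOCKET WITH `hM` DISCHARGED: `(dU_j).map (iterFrom …) ≤ (Σ_{s discoverable}
2^{|s|} w s) • ν` given `hw` on the discoverable histories only), and ★★★ `exists_socket_hM_of_not_discoverable` — **if the slices of `s` are NOT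
discoverable (w2's clause, negated), then `∃ σ ∈ s, ∀ s′ ⊆ s, σ ∉ s′ → ∀ B, MeasurableSet B → dU_j ((⋂ τ ∈ s, {U | Small ℰ (V (insert σ s′) τ.1 U) τ.2}) ∩ V (insert σ s′) n ⁻¹' B)
= dU_j ((⋂ τ ∈ s, {…V s′…}) ∩ V s′ n ⁻¹' B)`** — the body of the socket's `hM` binder for this `s`; so with `𝓜 := univ.filter (¬ discoverable ∘ slices)` the assembler's `hM` is
`fun s hs => exists_socket_hM_of_not_discoverable … (mem_filter.1 hs).2`, and every `s ∉ 𝓜` is discoverable by definition (w5's ✓`sum_pow_card_le_of_discoverable_T3` side).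

HONEST SCOPE.  [folklore] instantiation + dictionary over landed lemmas BY NAME; 0 `def`, 0 `instance`, standard axioms.  NOT here: the ONE recursion, (C′), `hw`, the assembly,
the smallness rows.  Nothing of hTop ∕ the χ record ∕ (O‴χₛ) ∕ `HistoryTailL` (19936) ∕ rung R3 is proved; R3 = SU(2) YM₃ on T³ — NOT d = 4, NOT infinite volume, NOT a mass gap,
NOT Clay; the YM mass gap is NOT proved.  References: T. Bałaban, Commun. Math. Phys. **109** (1987) 249–301 [Balaban1987RG1] ((0.3)–(0.4) pp. 252–253); T. Bałaban, Commun.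
Math. Phys. **95** (1984) 17–40 [Balaban1984PropagatorsI] ((1.7) p. 18); LEAD note §4 (M), §5 (M′).
-/

set_option autoImplicit false

noncomputable section
open MeasureTheory Function

namespace Summit.QuantumFields.YangMills.Theorems.UV3BranchExpansionMuteJoin

open Literature.MathematicalPhysics.QuantumFieldTheory.Balaban1983to89
open Literature.MathematicalPhysics.QuantumFieldTheory.Balaban1983to89.AveragingRT
open Literature.MathematicalPhysics.QuantumFieldTheory.Balaban1983to89.T4Continuum (walk loopWord)
open Literature.MathematicalPhysics.QuantumFieldTheory.Balaban1983to89.BlockAveraging (Idx off Small avgFun blockAvg)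
open Literature.MathematicalPhysics.QuantumFieldTheory.Balaban1983to89.T4AvgSensitivity (iterFrom)
open Summit.QuantumFields.YangMills.Theorems.UV3BranchExpansionMuteCancellation (socket_hM_of_mute)
open Summit.QuantumFields.YangMills.Theorems.UV3BranchExpansionMuteCancellationDead (socket_hM_of_deadTower)
open Summit.QuantumFields.YangMills.Theorems.UV3BranchExpansionMuteDichotomy (exists_mute_of_not_discoverable exists_exit_chain_rel)
open Summit.QuantumFields.YangMills.Theorems.UV3BranchExpansionGuardedTower (map_iterFrom_le_smul_of_branchExpansion)

variable {P : Params} [∀ k, DecidableEq (PBond P k)] {j n : ℕ}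
  (lineF Rd : (i : ℕ) → PBond P (j + i + 1) → Finset (PBond P (j + i)))
  (Dist : ((i : Fin n) → Finset (PBond P (j + i + 1))) → (i : ℕ) → Finset (PBond P (j + i)))
  (X : (m : ℕ) → Finset (PBond P (j + m)) → ((i : Fin n) → Finset (PBond P (j + i + 1))) → (i : ℕ) → Finset (PBond P (j + i)))
  (N : (i : ℕ) → Finset (PBond P (j + i + 1)) → Finset (PBond P (j + i + 1)))

omit [∀ k, DecidableEq (PBond P k)] in
/-- DICTIONARY: a family of tower memberships `t i ∈ lineF i (t (i+1))` on a range yields an explicit position function `τ` with `t i = line (t (i+1)) (τ i)`. [folklore] -/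
theorem forall_lt_of_mem_lineF (hlineF : ∀ i (g : PBond P (j + i + 1)) b, b ∈ lineF i g ↔ ∃ t, t < P.L ∧ b = line g t)
    (t : (i : ℕ) → PBond P (j + i)) {lo hi : ℕ} (h : ∀ i, lo ≤ i → i < hi → t i ∈ lineF i (t (i + 1))) :
    ∃ τ : ℕ → ℕ, ∀ i, lo ≤ i → i < hi → τ i < P.L ∧ t i = line (t (i + 1)) (τ i) := by
  classical
  refine ⟨fun i => if h' : lo ≤ i ∧ i < hi then Classical.choose ((hlineF i (t (i + 1)) (t i)).1 (h i h'.1 h'.2)) else 0, fun i h1 h2 => ?_⟩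
  simp only [dif_pos (And.intro h1 h2)]
  exact Classical.choose_spec ((hlineF i (t (i + 1)) (t i)).1 (h i h1 h2))

variable {G : Type*} [GaugeGroup G] (ℰ : LoopAverage G) [MeasurableSpace G] [RegularGaugeGroup G] [HaarData G]

/-- ★★★ **`hM` OF THE SOCKET FOR EVERY NON-DISCOVERABLE HISTORY.**  Let `s` be a history whose slices `p i := univ.filter (⟨i, ·⟩ ∈ s)` are NOT discoverable in the sense of
(C′) (w2's clause `∀ i, p i ⊆ X n (Dist p n) p (i+1) ∪ N i (X … ∖ p i)`, negated).  Then `s` has a site `σ` such that for every branch set `s′ ⊆ s` with `σ ∉ s′` and every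
measurable `B`, `dU_j ((⋂ τ ∈ s, {U | Small ℰ (V (insert σ s′) τ.1 U) τ.2}) ∩ V (insert σ s′) n ⁻¹' B) = dU_j ((⋂ τ ∈ s, {…V s′…}) ∩ V s′ n ⁻¹' B)` — the socket's `hM` clause.
PROOF: w5's `exists_mute_of_not_discoverable` gives a mute site with an unread Dist-tower ending EXIT or DEAD; the dictionary (`hlineF`, `hRd′`) turns it into the lattice data of
px8's `socket_hM_of_mute` (with the exit chain of w5's `exists_exit_chain_rel`) resp. `socket_hM_of_deadTower`. [cite: Balaban1987RG1, (0.3)–(0.4) pp.252–253] -/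
theorem exists_socket_hM_of_not_discoverable (hE : ∀ m, Measurable fun W : Fin (m + 1) → G => ℰ.E W)
    (V : Finset (Σ i : Fin n, PBond P (j + i + 1)) → (i : ℕ) → GaugeField P j G → GaugeField P (j + i) G)
    (hV0 : ∀ s U, V s 0 U = U)
    (hVs : ∀ s (i : ℕ) (hi : i < n) U, V s (i + 1) U = fun c =>
      if c ∈ (Finset.univ.filter fun c' => (⟨⟨i, hi⟩, c'⟩ : Σ i : Fin n, PBond P (j + i + 1)) ∈ s) then avgFun ℰ (V s i U) c else axialAvg (V s i U) c)
    (hjn : j + n ≤ P.m + P.K)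
    (hlineF : ∀ i (g : PBond P (j + i + 1)) b, b ∈ lineF i g ↔ ∃ t, t < P.L ∧ b = line g t)
    (hRd' : ∀ (i : ℕ) (c : PBond P (j + i + 1)) (b : PBond P (j + i)),
      (∃ (ι : Idx P), ∃ st ∈ walk (emb c.src) (loopWord P.L c.dir (off ι.1) ι.2.1 ι.2.2), st.bond = b) → b ∈ Rd i c)
    (hRline : ∀ i, i < n → ∀ g : PBond P (j + i + 1), lineF i g ⊆ Rd i g)
    (hXm : ∀ m (A : Finset (PBond P (j + m))) p, X m A p m = A)
    (hXS : ∀ m (A : Finset (PBond P (j + m))) p (i : Fin n), (i : ℕ) < m →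
      X m A p i = ((X m A p ((i : ℕ) + 1) \ p i).biUnion (lineF i) ∪ (p i).biUnion (Rd i)) ∩ Dist p i)
    (hDistS : ∀ p (i : Fin n) (g : PBond P (j + i + 1)), g ∈ Dist p ((i : ℕ) + 1) ↔ g ∈ p i ∨ lineF i g ⊆ Dist p i ∪ (p i).biUnion (Rd i))
    (s : Finset (Σ i : Fin n, PBond P (j + i + 1)))
    (hnd : ¬ ∀ i : Fin n,
      (Finset.univ.filter fun c' => (⟨i, c'⟩ : Σ i : Fin n, PBond P (j + i + 1)) ∈ s) ⊆
        X n (Dist (fun i => Finset.univ.filter fun c' => (⟨i, c'⟩ : Σ i : Fin n, PBond P (j + i + 1)) ∈ s) n)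
            (fun i => Finset.univ.filter fun c' => (⟨i, c'⟩ : Σ i : Fin n, PBond P (j + i + 1)) ∈ s) ((i : ℕ) + 1) ∪
          N i (X n (Dist (fun i => Finset.univ.filter fun c' => (⟨i, c'⟩ : Σ i : Fin n, PBond P (j + i + 1)) ∈ s) n)
              (fun i => Finset.univ.filter fun c' => (⟨i, c'⟩ : Σ i : Fin n, PBond P (j + i + 1)) ∈ s) ((i : ℕ) + 1) \
            (Finset.univ.filter fun c' => (⟨i, c'⟩ : Σ i : Fin n, PBond P (j + i + 1)) ∈ s))) :
    ∃ σ ∈ s, ∀ s' ⊆ s, σ ∉ s' → ∀ B : Set (GaugeField P (j + n) G), MeasurableSet B →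
      fieldMeasure P j G ((⋂ τ ∈ s, {U : GaugeField P j G | Small ℰ (V (insert σ s') τ.1 U) τ.2}) ∩ V (insert σ s') n ⁻¹' B) =
        fieldMeasure P j G ((⋂ τ ∈ s, {U : GaugeField P j G | Small ℰ (V s' τ.1 U) τ.2}) ∩ V s' n ⁻¹' B) := by
  set p : (i : Fin n) → Finset (PBond P (j + i + 1)) := fun i => Finset.univ.filter fun c' => (⟨i, c'⟩ : Σ i : Fin n, PBond P (j + i + 1)) ∈ s with hp
  have memp : ∀ (i : ℕ) (hi : i < n) (C : PBond P (j + i + 1)), C ∈ p ⟨i, hi⟩ ↔ (⟨⟨i, hi⟩, C⟩ : Σ i : Fin n, PBond P (j + i + 1)) ∈ s := by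
    intro i hi C; simp only [hp, Finset.mem_filter, Finset.mem_univ, true_and]
  -- w5's dichotomy: a mute site with its tower (its `Nonempty` instance: every level has a bond)
  haveI : ∀ i, Nonempty (PBond P (j + i)) := fun _ => ⟨⟨fun _ => 0, ⟨0, P.hd⟩⟩⟩
  obtain ⟨κ, hκ, c, hc, hmute⟩ := exists_mute_of_not_discoverable Rd lineF Dist X N hRline hXm hXS hDistS p hnd
  refine ⟨⟨⟨κ, hκ⟩, c⟩, (memp κ hκ c).1 hc, fun s' hs's _ B hB => ?_⟩
  -- unreadness in loop-word form from `t i ∉ Rd i c'`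
  have unread_of : ∀ (i : ℕ) (hi : i < n) (b : PBond P (j + i)), (∀ c' ∈ p ⟨i, hi⟩, b ∉ Rd i c') →
      ∀ C : PBond P (j + i + 1), (⟨⟨i, hi⟩, C⟩ : Σ i : Fin n, PBond P (j + i + 1)) ∈ s →
        ∀ (ι : Idx P), ∀ st ∈ walk (emb C.src) (loopWord P.L C.dir (off ι.1) ι.2.1 ι.2.2), st.bond ≠ b := by
    intro i hi b hb C hC ι st hst heq
    exact hb C ((memp i hi C).2 hC) (hRd' i C b ⟨ι, st, hst, heq⟩)
  rcases hmute with ⟨m, t, hκm, hmn, htc, htw, hun, -, hexit⟩ | ⟨m, t, hκm, hmn, htc, htw, hun, -, hdead⟩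
  · -- EXIT ending: positions along the tower, the exit chain of `t (m+1)`, then (F-M2b)
    obtain ⟨τ, hτ⟩ := forall_lt_of_mem_lineF lineF hlineF t htw
    obtain ⟨b, hbt, hb⟩ := exists_exit_chain_rel (β := fun i => PBond P (j + i)) Rd lineF Dist hDistS p m hmn (t (m + 1)) hexit
    obtain ⟨τ', hτ'⟩ := forall_lt_of_mem_lineF lineF hlineF b (lo := 0) (hi := m + 1) fun i _ hi => (hb i hi).1
    exact socket_hM_of_mute ℰ hE V hV0 hVs hjn s s' hs's hκ c ((memp κ hκ c).1 hc) (by omega) hmn t τ htc hτ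
      (fun i hi1 hi2 C hC => unread_of i (by omega) (t i) (hun i (by omega) hi1 hi2) C hC)
      b τ' hbt (fun i hi => hτ' i (Nat.zero_le i) hi)
      (fun i hi hmem => (hb i hi).2.2.2 ((memp i (by omega) _).2 hmem))
      (fun i hi C hC => unread_of i (by omega) (b i) (hb i hi).2.2.1 C hC) hB
  · -- DEAD ending: positions along the tower, then (F-M2c)
    obtain ⟨τ, hτ⟩ := forall_lt_of_mem_lineF lineF hlineF t htw
    refine socket_hM_of_deadTower ℰ V hV0 hVs hjn s s' hs's hκ c ((memp κ hκ c).1 hc) hκm hmn t τ htc hτ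
      (fun i hi1 hi2 C hC => unread_of i (by omega) (t i) (hun i (by omega) hi1 hi2) C hC) ?_ B
    intro C t' ht' heq
    exact hdead C ((hlineF m C (t m)).2 ⟨t', ht', heq.symm⟩)

/-- ★★★ **THE SOCKET WITH `hM` DISCHARGED: the K-fold guarded push-forward is dominated by the DISCOVERABLE histories alone.**  With the mute class
`𝓜 := univ.filter (¬ discoverable ∘ slices)`, LEAD's ✓`map_iterFrom_le_smul_of_branchExpansion` and `exists_socket_hM_of_not_discoverable` give: for every reference measure `ν`
and weights `w` dominating the branch measures of the DISCOVERABLE histories (`hw`, the (A)-side letter of w8 g12 restricted to discoverable `s`),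
**`(dU_j).map (iterFrom (blockAvg ℰ) j n) ≤ (Σ_{s discoverable} 2^{|s|}·w s) • ν`** — hTop modulo the activity `hw` and the count of discoverable histories ((C′), w2∕w5).
[cite: Balaban1987RG1, (0.4) p.253] -/
theorem map_iterFrom_le_smul_of_discoverable (hE : ∀ m, Measurable fun W : Fin (m + 1) → G => ℰ.E W)
    (V : Finset (Σ i : Fin n, PBond P (j + i + 1)) → (i : ℕ) → GaugeField P j G → GaugeField P (j + i) G)
    (hV0 : ∀ s U, V s 0 U = U)
    (hVs : ∀ s (i : ℕ) (hi : i < n) U, V s (i + 1) U = fun c =>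
      if c ∈ (Finset.univ.filter fun c' => (⟨⟨i, hi⟩, c'⟩ : Σ i : Fin n, PBond P (j + i + 1)) ∈ s) then avgFun ℰ (V s i U) c else axialAvg (V s i U) c)
    (hjn : j + n ≤ P.m + P.K)
    (hlineF : ∀ i (g : PBond P (j + i + 1)) b, b ∈ lineF i g ↔ ∃ t, t < P.L ∧ b = line g t)
    (hRd' : ∀ (i : ℕ) (c : PBond P (j + i + 1)) (b : PBond P (j + i)),
      (∃ (ι : Idx P), ∃ st ∈ walk (emb c.src) (loopWord P.L c.dir (off ι.1) ι.2.1 ι.2.2), st.bond = b) → b ∈ Rd i c)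
    (hRline : ∀ i, i < n → ∀ g : PBond P (j + i + 1), lineF i g ⊆ Rd i g)
    (hXm : ∀ m (A : Finset (PBond P (j + m))) p, X m A p m = A)
    (hXS : ∀ m (A : Finset (PBond P (j + m))) p (i : Fin n), (i : ℕ) < m →
      X m A p i = ((X m A p ((i : ℕ) + 1) \ p i).biUnion (lineF i) ∪ (p i).biUnion (Rd i)) ∩ Dist p i)
    (hDistS : ∀ p (i : Fin n) (g : PBond P (j + i + 1)), g ∈ Dist p ((i : ℕ) + 1) ↔ g ∈ p i ∨ lineF i g ⊆ Dist p i ∪ (p i).biUnion (Rd i))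
    (ν : Measure (GaugeField P (j + n) G)) (w : Finset (Σ i : Fin n, PBond P (j + i + 1)) → ENNReal)
    (hw : ∀ s : Finset (Σ i : Fin n, PBond P (j + i + 1)),
      (∀ i : Fin n,
        (Finset.univ.filter fun c' => (⟨i, c'⟩ : Σ i : Fin n, PBond P (j + i + 1)) ∈ s) ⊆
          X n (Dist (fun i => Finset.univ.filter fun c' => (⟨i, c'⟩ : Σ i : Fin n, PBond P (j + i + 1)) ∈ s) n)
              (fun i => Finset.univ.filter fun c' => (⟨i, c'⟩ : Σ i : Fin n, PBond P (j + i + 1)) ∈ s) ((i : ℕ) + 1) ∪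
            N i (X n (Dist (fun i => Finset.univ.filter fun c' => (⟨i, c'⟩ : Σ i : Fin n, PBond P (j + i + 1)) ∈ s) n)
                (fun i => Finset.univ.filter fun c' => (⟨i, c'⟩ : Σ i : Fin n, PBond P (j + i + 1)) ∈ s) ((i : ℕ) + 1) \
              (Finset.univ.filter fun c' => (⟨i, c'⟩ : Σ i : Fin n, PBond P (j + i + 1)) ∈ s))) →
      ∀ s' ⊆ s, ∀ B : Set (GaugeField P (j + n) G), MeasurableSet B →
        fieldMeasure P j G ((⋂ τ ∈ s, {U : GaugeField P j G | Small ℰ (V s' τ.1 U) τ.2}) ∩ V s' n ⁻¹' B) ≤ w s * ν B) :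
    (fieldMeasure P j G).map (iterFrom (fun k => blockAvg (P := P) (j := k) ℰ) j n) ≤
      (∑ s ∈ Finset.univ.filter (fun s : Finset (Σ i : Fin n, PBond P (j + i + 1)) => ∀ i : Fin n,
        (Finset.univ.filter fun c' => (⟨i, c'⟩ : Σ i : Fin n, PBond P (j + i + 1)) ∈ s) ⊆
          X n (Dist (fun i => Finset.univ.filter fun c' => (⟨i, c'⟩ : Σ i : Fin n, PBond P (j + i + 1)) ∈ s) n)
              (fun i => Finset.univ.filter fun c' => (⟨i, c'⟩ : Σ i : Fin n, PBond P (j + i + 1)) ∈ s) ((i : ℕ) + 1) ∪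
            N i (X n (Dist (fun i => Finset.univ.filter fun c' => (⟨i, c'⟩ : Σ i : Fin n, PBond P (j + i + 1)) ∈ s) n)
                (fun i => Finset.univ.filter fun c' => (⟨i, c'⟩ : Σ i : Fin n, PBond P (j + i + 1)) ∈ s) ((i : ℕ) + 1) \
              (Finset.univ.filter fun c' => (⟨i, c'⟩ : Σ i : Fin n, PBond P (j + i + 1)) ∈ s))),
        2 ^ s.card * w s) • ν := by
  classical
  -- the mute class: the non-discoverable histories
  set disc : Finset (Σ i : Fin n, PBond P (j + i + 1)) → Prop := fun s => ∀ i : Fin n,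
        (Finset.univ.filter fun c' => (⟨i, c'⟩ : Σ i : Fin n, PBond P (j + i + 1)) ∈ s) ⊆
          X n (Dist (fun i => Finset.univ.filter fun c' => (⟨i, c'⟩ : Σ i : Fin n, PBond P (j + i + 1)) ∈ s) n)
              (fun i => Finset.univ.filter fun c' => (⟨i, c'⟩ : Σ i : Fin n, PBond P (j + i + 1)) ∈ s) ((i : ℕ) + 1) ∪
            N i (X n (Dist (fun i => Finset.univ.filter fun c' => (⟨i, c'⟩ : Σ i : Fin n, PBond P (j + i + 1)) ∈ s) n)
                (fun i => Finset.univ.filter fun c' => (⟨i, c'⟩ : Σ i : Fin n, PBond P (j + i + 1)) ∈ s) ((i : ℕ) + 1) \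
              (Finset.univ.filter fun c' => (⟨i, c'⟩ : Σ i : Fin n, PBond P (j + i + 1)) ∈ s)) with hdisc
  have hmain := map_iterFrom_le_smul_of_branchExpansion ℰ j n V hE hV0 hVs (Finset.univ.filter fun s => ¬ disc s)
    (fun s hs => exists_socket_hM_of_not_discoverable lineF Rd Dist X N ℰ hE V hV0 hVs hjn hlineF hRd' hRline hXm hXS hDistS s
      (Finset.mem_filter.1 hs).2)
    ν w (fun s hs => hw s (by simpa [Finset.mem_filter] using hs))
  have hset : Finset.univ \ Finset.univ.filter (fun s => ¬ disc s) = Finset.univ.filter fun s => disc s := by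
    ext s; simp [Finset.mem_sdiff, Finset.mem_filter]
  rw [hset] at hmain
  exact hmain

end Summit.QuantumFields.YangMills.Theorems.UV3BranchExpansionMuteJoin

end
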